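import Literature.AlgebraicGeometry.Resolution.Hironaka1964LocalComplete
import Literature.AlgebraicGeometry.Resolution.GRingAdicCompletionRegularHom
import Literature.AlgebraicGeometry.Resolution.Temkin2008OfHironaka
import Literature.AlgebraicGeometry.Resolution.LUCompleteChar0TrustBase
import HarnessLib

/-!
# `Hironaka1964_local`, `Temkin2008` and the characteristic-zero leaf of Cossart–Piltant 2019
# modulo the complete principal affine case alone

Topic: `Literature/AlgebraicGeometry/Resolution`. Proofs only: no new notions, no new named facts.

The named fact `Hironaka1964_local` (`Temkin2008Localization.lean`) is Hironaka's Main Theorem I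
in the generality recorded by Temkin 2008 — resolution of singularities over every LOCAL
quasi-excellent ring of residue characteristic zero ("Hironaka proved that any integral scheme
of finite type over a local quasi-excellent ring of residue characteristic zero admits a
successive embedded resolution of singularities", arXiv text chunk p. 3, lines 16–18; Thm. 2.3.6,
chunk p. 13, lines 1–8). It is distinct from, and not implied in the tree by, the FIELD form
`Hironaka1964 := ResolutionInChar 0` (`ResolutionOfSingularities.lean`), which is a theorem
(`Hironaka1964_holds`, Kollár 2007 Thms 3.103/3.107).

`Hironaka1964LocalComplete.lean` reduced `Hironaka1964_local`, along Temkin's own road (proof of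
Thm. 3.4.1, chunk p. 18), to two hypotheses:

  (REG) for every quasi-excellent ring `A` and ideal `I`, `A → Â_I` is a regular homomorphism
        (EGA IV₂ (7.8.3) (v), as invoked in Temkin's Lemma 3.1.4), and
  (Â)  the complete principal affine case: for a Noetherian ring `A`, complete for the `g`-adic
        topology, reduced, containing `ℚ`, with `A_𝔭` regular for all `𝔭 ∌ g` and `A/gA` of
        finite type over a field, every blow-up `Y → Spec A` centred in `V(g)` admits a
        desingularization

(`hironaka1964_local_of_complete`), and `GRingAdicCompletionRegularHom.lean` PROVED (REG)
(`isRegularHom_adicCompletion_of_isQuasiExcellentRing`). This file records the assembly: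

* `hironaka1964_local_of_completePrincipalAffine` — **(Â) ⟹ `Hironaka1964_local`**;
* `temkin2008_of_completePrincipalAffine` — **(Â) ⟹ `Temkin2008`**
  (through `temkin2008_of_hironaka1964_local`, Temkin's Thm. 2.3.6 with `Z = ∅`);
* `cossartPiltant2019LUCompleteChar0_of_completePrincipalAffine` — **(Â) ⟹
  `CossartPiltant2019LUCompleteChar0`** (the residue-characteristic-zero leaf of Cossart–Piltant
  2019, Thm. 1.1, through `CossartPiltant2019LUCompleteChar0.of_hironaka1964_local`).

So the named facts `Hironaka1964_local`, `Temkin2008` and `CossartPiltant2019LUCompleteChar0`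
all rest on the single hypothesis (Â), i.e. on what Temkin's local step supplies for
`𝔛₀ = Spf Â`: Prop. 3.2.3 (`𝔛₀` is a formal `k[[π]]`-scheme of finite type, chunk p. 16,
lines 19–23), Prop. 3.3.1 (Elkik: a rig-regular affine formal scheme of finite type over
`Spf k[[π]]`, `char k = 0`, is `k[π]`-algebraizable, chunk p. 16, lines 41–58), the comparison
lemmas 2.1.8 / 3.1.4 / Cor. 3.1.5, and strict embedded resolution over fields of characteristic
zero (Cor. 2.3.5, from [BM]). (Â) appears only as a hypothesis; it is not a named fact.

## Sources

* M. Temkin, *Desingularization of quasi-excellent schemes in characteristic zero*, Adv. Math.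
  219 (2008) 488–522 = arXiv:math/0703678: §1 (chunk p. 3, lines 16–18, 32–48), Cor. 2.3.5
  (chunk p. 12), Thm. 2.3.6 (chunk p. 13, lines 1–8), Prop. 3.2.3 and Prop. 3.3.1 (chunk p. 16),
  Thm. 3.4.1 and its proof (chunk p. 18). [Temkin2008]
* H. Hironaka, *Resolution of singularities of an algebraic variety over a field of
  characteristic zero I*, Ann. of Math. 79 (1964) 109–203, Main Theorem I (cite-only; the
  statement is taken as read by Temkin 2008). [Hironaka1964]
* A. Grothendieck, EGA IV₂, (7.8.3) (v). [EGAIV2]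
* V. Cossart, O. Piltant, *Resolution of singularities of arithmetical threefolds*, J. Algebra
  529 (2019) 268–535, proof of Prop. 4.10 (arXiv v1: Prop. 4.8), first paragraph.
  [CossartPiltant2019]
-/

noncomputable section

open CategoryTheory AlgebraicGeometry IsLocalRing

namespace Literature.AlgebraicGeometry.Resolution

universe u

/-- **The complete principal affine case (Â) implies `Hironaka1964_local`**: the reduction
`hironaka1964_local_of_complete` (Temkin 2008, proof of Thm. 3.4.1 run on the scheme, with the
honest base change `Y ×_{Spec A} Spec Â` in place of the formal completion) has the two hypotheses
(REG) and (Â); (REG) — `A → Â_I` is regular for every quasi-excellent `A` and every ideal `I`,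
EGA IV₂ (7.8.3) (v) — is the theorem `isRegularHom_adicCompletion_of_isQuasiExcellentRing`, so
(Â) alone suffices. [cite: Temkin2008, Thm. 3.4.1 (proof) and Thm. 2.3.6]
[cite: EGAIV2, (7.8.3) (v)] [cite: Hironaka1964, Main Theorem I] -/
theorem hironaka1964_local_of_completePrincipalAffine
    (hcpl : ∀ (A : Type u) [CommRing A] [IsNoetherianRing A] (g : A),
      IsAdicComplete (Ideal.span {g}) A → IsReduced A → (∀ n : ℕ, n ≠ 0 → IsUnit (n : A)) →
      (∀ P : PrimeSpectrum A, g ∉ P.asIdeal → P ∈ regularLocus A) →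
      (∃ (k : Type u) (_ : Field k) (_ : Algebra k (A ⧸ Ideal.span {g})),
          Algebra.FiniteType k (A ⧸ Ideal.span {g})) →
      ∀ (Y : Scheme.{u}) (q : Y ⟶ Spec (.of A)) (Q : (Spec (.of A)).IdealSheafData),
        IsBlowup q Q → (∀ y ∈ Q.support, g ∈ y.asIdeal) → Scheme.AdmitsDesingularization Y) :
    Hironaka1964_local.{u} :=
  hironaka1964_local_of_complete
    (fun A _ hA I => isRegularHom_adicCompletion_of_isQuasiExcellentRing (A := A) I hA) hcpl

/-- **(Â) implies `Temkin2008`**: the named fact `Temkin2008` (non-embedded desingularization of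
Noetherian quasi-excellent integral schemes with residue fields of characteristic zero) rests on
the single leaf `Hironaka1964_local` (`temkin2008_of_hironaka1964_local`, Temkin 2008 Thm. 2.3.6
with `Z = ∅` via Prop. 2.3.4), hence on (Â) alone. [cite: Temkin2008, Thm. 2.3.6, Prop. 2.3.4,
Thm. 3.4.1] -/
theorem temkin2008_of_completePrincipalAffine
    (hcpl : ∀ (A : Type u) [CommRing A] [IsNoetherianRing A] (g : A),
      IsAdicComplete (Ideal.span {g}) A → IsReduced A → (∀ n : ℕ, n ≠ 0 → IsUnit (n : A)) →
      (∀ P : PrimeSpectrum A, g ∉ P.asIdeal → P ∈ regularLocus A) →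
      (∃ (k : Type u) (_ : Field k) (_ : Algebra k (A ⧸ Ideal.span {g})),
          Algebra.FiniteType k (A ⧸ Ideal.span {g})) →
      ∀ (Y : Scheme.{u}) (q : Y ⟶ Spec (.of A)) (Q : (Spec (.of A)).IdealSheafData),
        IsBlowup q Q → (∀ y ∈ Q.support, g ∈ y.asIdeal) → Scheme.AdmitsDesingularization Y) :
    Temkin2008.{u} :=
  temkin2008_of_hironaka1964_local (hironaka1964_local_of_completePrincipalAffine hcpl)

/-- **(Â) implies the residue-characteristic-zero leaf of Cossart–Piltant 2019**: the named fact
`CossartPiltant2019LUCompleteChar0` ((LU) for complete Noetherian local domains of dimension three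
with residue field of characteristic zero; "the equicharacteristic zero version of theorem 1.1
being known") rests on `Hironaka1964_local` (`CossartPiltant2019LUCompleteChar0.of_hironaka1964_local`),
hence on (Â) alone. [cite: CossartPiltant2019, proof of Prop. 4.10 (arXiv v1: Prop. 4.8), first
paragraph] [cite: Temkin2008, Thm. 2.3.6] -/
theorem cossartPiltant2019LUCompleteChar0_of_completePrincipalAffine
    (hcpl : ∀ (A : Type u) [CommRing A] [IsNoetherianRing A] (g : A),
      IsAdicComplete (Ideal.span {g}) A → IsReduced A → (∀ n : ℕ, n ≠ 0 → IsUnit (n : A)) →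
      (∀ P : PrimeSpectrum A, g ∉ P.asIdeal → P ∈ regularLocus A) →
      (∃ (k : Type u) (_ : Field k) (_ : Algebra k (A ⧸ Ideal.span {g})),
          Algebra.FiniteType k (A ⧸ Ideal.span {g})) →
      ∀ (Y : Scheme.{u}) (q : Y ⟶ Spec (.of A)) (Q : (Spec (.of A)).IdealSheafData),
        IsBlowup q Q → (∀ y ∈ Q.support, g ∈ y.asIdeal) → Scheme.AdmitsDesingularization Y) :
    CossartPiltant2019LUCompleteChar0.{u} :=
  CossartPiltant2019LUCompleteChar0.of_hironaka1964_local
    (hironaka1964_local_of_completePrincipalAffine hcpl)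

end Literature.AlgebraicGeometry.Resolution

end
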